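import Summits.QuantumFields.YangMills.Theorems.UnitScaleTiltHalvingP1FlatCoreFrameLinTower
import HarnessLib

/-!
# N07 [B11] (= [15]) Sect. F — CERTIFICATE (C1) OF PLAN RULING A3⁗, PART A (generic): **A GAUGE MAP THAT IS CONSTANT ON A BLOCK TOWER CONJUGATES THE SYMMETRIC FRAMES AND IS ITS
# OWN EFFECTIVE GAUGE** — along the tower under a coarse site `y`, the accumulated double-bar frames of `W^{g}` are `c·Ṽ(W)·c⁻¹` when `g ≡ c` on the fine sites under `y`

Cell `pub-ymgap`, seat `pub-ymgap-dag-n07-e` g27 (FAN-OUT §N07 row s3; LANE OWNER of the K0 road), MODULE 92a (INTENT-92, cell bus).  `--kind proof --supports stmt-QuantumFields-20541 --as helper`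
(K0⁷); count-neutral; THEOREMS ONLY (0 `def`), generic complete normed `ℂ`-algebra `𝔸`, any `P : Params`.  [3] = [Balaban1985Averaging]; [I] = [Balaban1987RG1].

WHY (plan g91 RULING A3⁗ (C1), cell bus 2026-08-29 08:39Z).  MODULE 91's `NrmDbarOfRecord` normalises S3's gauge `u` by the per-site equation `(V_{j′} y)⁻¹·u↾(y) = (h̄·w)↾(y)` in the
ACCUMULATED frames `V` of `(U^u)♮` — frames that depend on `u` (the self-reference the plan asks to close).  The certificate exhibits `u := g·(h̄·w)` with `g` CONSTANT (`= c_y`) on the whole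
block tower under each cell `y`; this file is the generic algebra that makes it work: for a fine map `g` with `g ≡ c` on the fine sites under a coarse site `y′`, (i) the symmetric frame is
conjugated, `vframeU (Z^{g↾}) y′ = c·vframeU Z y′·c⁻¹` ([I] (0.6) for `eml`, `eml_conj`); (ii) UST's EFFECTIVE GAUGE of `g` down the double-bar tower of `W` (the family `κ` of
★`P1FlatCoreFrameLinTower.dbarIterU_gaugeActT_eq_effGauge`: `dbar_i(W^g) = (dbar_i W)^{κ_i}`) stays `≡ c` at every site whose fine tower is under the constancy region; (iii) hence the
accumulated frames of `W^{g}` ([3] (97); UST `exists_accFrames_dbarIterU`'s recursion) are `V_i(y′) = c·Ṽ_i(W)(y′)·c⁻¹` there, `Ṽ` the accumulated frames of `W` itself.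

WHAT IS PROVED (sorry-free; axioms standard).
* §1 `vframeU_gaugeActT_of_const` — (i).
* §2 `effGauge_const_of_under` — (ii), by induction on the level (standing range `i ≤ m + K` for the block geometry).
* §3 ★★ `accFrames_gaugeActT_of_under` — (iii).
HONEST SCOPE: identities of the formal objects (no smallness, no unitarity); nothing of [15]∕[3]∕[I] analysis; K0⁷ NOT closed; N07 NOT discharged; one finite 𝕋⁴ programme at fixed ε — the
route closes the conditional finite-𝕋⁴ rung `BalabanLadder.UV` ONLY; the YM mass gap (Clay) is NOT proved by any of this; nothing continuum ∕ ℝ⁴ ∕ OS.  No `def`, no `instance`, no `notation`, no `sorry`.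

References: [3] (11) p. 19, (84) p. 30, (89) p. 31, (92) p. 31, (97)–(100) p. 32, (110) p. 34; [I] (0.4), (0.6), (0.11) p. 253.
-/

set_option autoImplicit false

noncomputable section

namespace Summit.QuantumFields.YangMills.BalabanUVNodes.N07DbarFramesBlockConst

open Literature.MathematicalPhysics.QuantumFieldTheory.Balaban1983to89
open T4Continuum BlockAveraging ExpMeanLog
open B10Eq27TorusAxialLog (holT gaugeActT gaugeActT_apply)
open B5Eq118OneStroke (iterBlockOf iterBlockOf_succ iterBlockOf_zero)
open BlockAveragingEMLLinearised (walkEnd_emb_stairWord_eq_blockSite)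
open Summit.QuantumFields.YangMills.Theorems.Prop8Chart (holT_gaugeActT)
open Summit.QuantumFields.YangMills.Theorems.Prop8ChartDoubleBar (vframeU coe_vframeU dbarIterU)
open Summit.QuantumFields.YangMills.Theorems.P1FlatCoreFrameLinTower (dbarIterU_gaugeActT_eq_effGauge)

variable {P : Params} {𝔸 : Type*} [NormedRing 𝔸] [NormedAlgebra ℂ 𝔸] [CompleteSpace 𝔸]

/-! ## §1  A block-constant map conjugates the symmetric frame -/

/-- **(0.6) FOR THE SYMMETRIC FRAME**: if a gauge map `g` of `T^{(i)}` equals `c` at the centre `emb y` and at every block site `blockSite y r`, then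
`vframeU (Z^{g}) y = c · vframeU Z y · c⁻¹` (every stair transporter is `c·Z(Γ)·c⁻¹` by [3] (11), and `eml` commutes with conjugation). [cite: Balaban1987RG1, (0.6) p.253; Balaban1985Averaging, (11) p.19, (110) p.34] -/
theorem vframeU_gaugeActT_of_const {i : ℕ} (Z : GaugeField P i 𝔸ˣ) (g : GaugeTransf P i 𝔸ˣ) (y : Site P (i + 1)) (c : 𝔸ˣ)
    (hctr : g (emb y) = c) (hblk : ∀ r : Fin P.d → Fin P.L, g (Site.blockSite y r) = c) :
    vframeU (gaugeActT g Z) y = c * vframeU Z y * c⁻¹ := by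
  apply Units.ext
  rw [coe_vframeU, Units.val_mul, Units.val_mul, coe_vframeU]
  have hfam : (fun idx : Idx P => ((holT (gaugeActT g Z) (emb y) (stairWord idx.2.1 (off idx.1)) : 𝔸ˣ) : 𝔸)) =
      fun idx : Idx P => (c : 𝔸) * ((holT Z (emb y) (stairWord idx.2.1 (off idx.1)) : 𝔸ˣ) : 𝔸) * ((c⁻¹ : 𝔸ˣ) : 𝔸) := by
    funext idx
    rw [holT_gaugeActT, walkEnd_emb_stairWord_eq_blockSite, hctr, hblk, Units.val_mul, Units.val_mul]
  rw [hfam, eml_conj (Units.mul_inv c) (Units.inv_mul c)]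

/-! ## §2  The effective gauge of a map constant under a site is that constant -/

/-- **THE EFFECTIVE GAUGE STAYS CONSTANT UNDER A CONSTANCY REGION**: for the effective-gauge family `κ` of a fine map `g` down the double-bar tower of `W` (`κ 0 = g`,
`κ (i+1) y′ = vframeU ((dbar_i W)^{κ_i}) y′⁻¹ · κ_i (emb y′) · vframeU (dbar_i W) y′`), at every level `i ≤ m + K` and every site `y′` of `T^{(i)}` ALL of whose fine sites carry the value
`c` (`∀ x, iterBlockOf i x = y′ → g x = c`), `κ i y′ = c`. [cite: Balaban1985Averaging, (84) p.30, (97)–(100) p.32] -/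
theorem effGauge_const_of_under (W : GaugeField P 0 𝔸ˣ) (g : GaugeTransf P 0 𝔸ˣ) (κ : (i : ℕ) → GaugeTransf P i 𝔸ˣ) (h0 : κ 0 = g)
    (hs : ∀ (i : ℕ) (y : Site P (i + 1)), κ (i + 1) y = (vframeU (gaugeActT (κ i) (dbarIterU i W)) y)⁻¹ * κ i (emb y) * vframeU (dbarIterU i W) y)
    (c : 𝔸ˣ) : ∀ (i : ℕ), i ≤ P.m + P.K → ∀ (y : Site P i), (∀ x : Site P 0, iterBlockOf i x = y → g x = c) → κ i y = c
  | 0, _, y, hy => by rw [h0]; exact hy y (iterBlockOf_zero y)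
  | i + 1, hi, y, hy => by
    have hi' : i ≤ P.m + P.K := by omega
    -- the sites of `B(y)` and the centre have their fine towers under `y`
    have hunder : ∀ z : Site P i, blockOf z = y → κ i z = c := fun z hz =>
      effGauge_const_of_under W g κ h0 hs c i hi' z fun x hx => hy x (by rw [iterBlockOf_succ, hx, hz])
    have hctr : κ i (emb y) = c := hunder _ (Site.blockOf_emb hi y)
    have hblk : ∀ r : Fin P.d → Fin P.L, κ i (Site.blockSite y r) = c := fun r => hunder _ (Site.blockOf_blockSite hi y r)
    rw [hs i y, vframeU_gaugeActT_of_const (dbarIterU i W) (κ i) y c hctr hblk, hctr]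
    -- `(c · v · c⁻¹)⁻¹ · c · v = c`
    group

/-! ## §3  The accumulated frames of `W^{g}` under a constancy region -/

/-- ★★ **ACCUMULATED FRAMES OF A TRANSFORMED FIELD UNDER A CONSTANCY REGION**: with `κ` the effective gauge of `g` down the double-bar tower of `W`, `Ṽ` the accumulated frames of `W`
and `V` those of `W^{g}` (both by the (97) recursion), at every level `i ≤ m + K` and every site `y′` whose fine tower carries the constant `c`:  `V i y′ = c · Ṽ i y′ · c⁻¹`.
(UST ★`dbarIterU_gaugeActT_eq_effGauge`: `dbar_i(W^g) = (dbar_i W)^{κ_i}`; §2; §1.) [cite: Balaban1985Averaging, (92) p.31, (97)–(100) p.32; Balaban1987RG1, (0.6) p.253] -/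
theorem accFrames_gaugeActT_of_under (W : GaugeField P 0 𝔸ˣ) (g : GaugeTransf P 0 𝔸ˣ) (κ : (i : ℕ) → GaugeTransf P i 𝔸ˣ) (h0 : κ 0 = g)
    (hs : ∀ (i : ℕ) (y : Site P (i + 1)), κ (i + 1) y = (vframeU (gaugeActT (κ i) (dbarIterU i W)) y)⁻¹ * κ i (emb y) * vframeU (dbarIterU i W) y)
    (Vt : (i : ℕ) → Site P i → 𝔸ˣ) (hVt0 : ∀ x, Vt 0 x = 1) (hVts : ∀ (i : ℕ) (y : Site P (i + 1)), Vt (i + 1) y = Vt i (emb y) * vframeU (dbarIterU i W) y)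
    (V : (i : ℕ) → Site P i → 𝔸ˣ) (hV0 : ∀ x, V 0 x = 1) (hVs : ∀ (i : ℕ) (y : Site P (i + 1)), V (i + 1) y = V i (emb y) * vframeU (dbarIterU i (gaugeActT g W)) y)
    (c : 𝔸ˣ) : ∀ (i : ℕ), i ≤ P.m + P.K → ∀ (y : Site P i), (∀ x : Site P 0, iterBlockOf i x = y → g x = c) → V i y = c * Vt i y * c⁻¹
  | 0, _, y, _ => by rw [hV0, hVt0, mul_one, mul_inv_cancel]
  | i + 1, hi, y, hy => by
    have hi' : i ≤ P.m + P.K := by omega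
    have hunderg : ∀ z : Site P i, blockOf z = y → ∀ x : Site P 0, iterBlockOf i x = z → g x = c := fun z hz x hx =>
      hy x (by rw [iterBlockOf_succ, hx, hz])
    have hκ : ∀ z : Site P i, blockOf z = y → κ i z = c := fun z hz => effGauge_const_of_under W g κ h0 hs c i hi' z (hunderg z hz)
    have hctr : κ i (emb y) = c := hκ _ (Site.blockOf_emb hi y)
    have hblk : ∀ r : Fin P.d → Fin P.L, κ i (Site.blockSite y r) = c := fun r => hκ _ (Site.blockOf_blockSite hi y r)
    have ih : V i (emb y) = c * Vt i (emb y) * c⁻¹ := accFrames_gaugeActT_of_under W g κ h0 hs Vt hVt0 hVts V hV0 hVs c i hi' (emb y) (hunderg _ (Site.blockOf_emb hi y))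
    rw [hVs i y, dbarIterU_gaugeActT_eq_effGauge W g κ h0 hs i, vframeU_gaugeActT_of_const (dbarIterU i W) (κ i) y c hctr hblk, ih, hVts i y]
    -- `(c Ṽᵢ c⁻¹)(c v c⁻¹) = c (Ṽᵢ v) c⁻¹`
    group

end Summit.QuantumFields.YangMills.BalabanUVNodes.N07DbarFramesBlockConst

end
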